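import Mathlib.MeasureTheory.Constructions.Projective
import Mathlib.Probability.Distributions.Gaussian.Basic
import Literature.Probability.LatticeModels.DiscreteGFFDirichletField
import HarnessLib

/-!
# The law of the discrete free field is unique, and translation invariant

Topic `Literature/Probability/LatticeModels`. Brick 8 of the proof of
`Literature.Probability.LatticeModels.Lupu2016_cableSignClustersBounded` (Lupu 2016, Prop. 5.5,
whose Lemma 5.3 uses "translation invariance" of the model). On the canonical space `ℤ^d → ℝ`:

* `IsDiscreteGFF.eq_of_isDiscreteGFF` — two probability measures under which the coordinate
  process is a discrete free field (`IsDiscreteGFF`: Gaussian, centred, covariance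
  `latticeGreen (x - y) / 2`) are EQUAL: their finite-dimensional marginals are Gaussian measures
  with the same characteristic functional (every continuous linear functional of `φ|_I` is a
  finite combination `∑ c_i φ_i`, whose mean `0` and variance `∑ c_i c_j G(i - j)` are dictated by
  the covariance), and a measure on the product space is determined by its marginals
  (Mathlib's `IsProjectiveLimit.unique`);
* `IsDiscreteGFF.map_shift_eq` — hence the free-field law is invariant under the lattice
  translations `φ ↦ φ(· + v)` (the translated field is again a free field with the same
  covariance, `IsDiscreteGFF.map_field`).

References: T. Lupu, Ann. Probab. 44 (2016), §1 and Lemma 5.3 [`Lupu2016`]; the statements are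
classical (a centred Gaussian process is determined in law by its covariance), tagged `[folklore]`.
-/

noncomputable section

namespace Literature.Probability.LatticeModels

open _root_.MeasureTheory _root_.ProbabilityTheory Finset
open scoped ENNReal NNReal

variable {d : ℕ}

namespace IsDiscreteGFF

variable {ν ν' : Measure (Site d → ℝ)}

/-- A continuous linear functional of `φ|_I` is the finite combination
`∑_{i ∈ I} φ_i · L(e_i)` of coordinates. [folklore] -/
theorem clm_restrict_eq_sum (I : Finset (Site d)) (L : (I → ℝ) →L[ℝ] ℝ) (φ : Site d → ℝ) :
    L (I.restrict φ) = ∑ i : I, φ i * L (fun j => if i = j then 1 else 0) := by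
  have h := L.toLinearMap.pi_apply_eq_sum_univ (I.restrict φ)
  simp only [ContinuousLinearMap.coe_coe] at h
  rw [h]
  simp [smul_eq_mul]

/-- **The mean of a linear functional of a marginal is `0`.** [folklore] -/
theorem integral_clm_restrict (hν : IsDiscreteGFF ν (coordProc d)) (I : Finset (Site d))
    (L : (I → ℝ) →L[ℝ] ℝ) : ∫ φ, L (I.restrict φ) ∂ν = 0 := by
  have hint : ∀ i : I, Integrable (fun φ : Site d → ℝ => φ i * L (fun j => if i = j then 1 else 0)) ν :=
    fun i => ((hν.1.hasGaussianLaw_eval (i : Site d)).integrable).mul_const _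
  simp_rw [clm_restrict_eq_sum]
  rw [integral_finsetSum _ fun i _ => hint i]
  refine Finset.sum_eq_zero fun i _ => ?_
  rw [integral_mul_const, hν.2.1, zero_mul]

/-- **The second moment of a linear functional of a marginal** is `∑_{i,j} c_i c_j G(i - j)`,
`G = latticeGreen / 2`, `c_i = L(e_i)` — determined by the covariance. [folklore] -/
theorem integral_clm_restrict_sq (hν : IsDiscreteGFF ν (coordProc d)) (I : Finset (Site d))
    (L : (I → ℝ) →L[ℝ] ℝ) :
    ∫ φ, L (I.restrict φ) ^ 2 ∂ν = ∑ i : I, ∑ j : I, L (fun k => if i = k then 1 else 0) *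
      L (fun k => if j = k then 1 else 0) * (latticeGreen ((i : Site d) - (j : Site d)) / 2) := by
  have hint : ∀ i j : I, Integrable (fun φ : Site d → ℝ =>
      L (fun k => if i = k then 1 else 0) * L (fun k => if j = k then 1 else 0) * (φ i * φ j)) ν :=
    fun i j => (hν.integrable_coord_mul i j).const_mul _
  have hexp : ∀ φ : Site d → ℝ, L (I.restrict φ) ^ 2 = ∑ i : I, ∑ j : I,
      L (fun k => if i = k then 1 else 0) * L (fun k => if j = k then 1 else 0) * (φ i * φ j) := by
    intro φ
    rw [clm_restrict_eq_sum, sq, Finset.sum_mul_sum]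
    exact Finset.sum_congr rfl fun i _ => Finset.sum_congr rfl fun j _ => by ring
  simp_rw [hexp]
  rw [integral_finsetSum _ fun i _ => integrable_finsetSum _ fun j _ => hint i j]
  refine Finset.sum_congr rfl fun i _ => ?_
  rw [integral_finsetSum _ fun j _ => hint i j]
  refine Finset.sum_congr rfl fun j _ => ?_
  rw [integral_const_mul, hν.2.2]

/-- **Equal finite-dimensional marginals**: two free-field laws have the same marginal on every
finite set of sites (Gaussian measures with equal characteristic functionals). [folklore] -/
theorem map_restrict_eq (hν : IsDiscreteGFF ν (coordProc d)) (hν' : IsDiscreteGFF ν' (coordProc d))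
    (I : Finset (Site d)) :
    ν.map (fun φ => I.restrict φ) = ν'.map (fun φ => I.restrict φ) := by
  have hP := hν.1.isProbabilityMeasure
  have hP' := hν'.1.isProbabilityMeasure
  have hG : IsGaussian (ν.map fun φ : Site d → ℝ => I.restrict φ) :=
    (hν.1.hasGaussianLaw I).isGaussian_map
  have hG' : IsGaussian (ν'.map fun φ : Site d → ℝ => I.restrict φ) :=
    (hν'.1.hasGaussianLaw I).isGaussian_map
  have hr : Measurable fun φ : Site d → ℝ => I.restrict φ := by fun_prop
  apply Measure.ext_of_charFunDual
  ext L
  have hmean : ∀ {μ : Measure (Site d → ℝ)}, IsDiscreteGFF μ (coordProc d) →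
      ∫ x, L x ∂μ.map (fun φ : Site d → ℝ => I.restrict φ) = 0 := by
    intro μ hμ
    rw [integral_map hr.aemeasurable L.continuous.aestronglyMeasurable]
    exact hμ.integral_clm_restrict I L
  have hvar : ∀ {μ : Measure (Site d → ℝ)}, IsDiscreteGFF μ (coordProc d) →
      Var[L; μ.map (fun φ : Site d → ℝ => I.restrict φ)] =
        ∑ i : I, ∑ j : I, L (fun k => if i = k then 1 else 0) *
          L (fun k => if j = k then 1 else 0) * (latticeGreen ((i : Site d) - (j : Site d)) / 2) := by
    intro μ hμ
    rw [variance_map L.continuous.aemeasurable hr.aemeasurable,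
      variance_of_integral_eq_zero (L.continuous.measurable.comp hr).aemeasurable]
    · exact hμ.integral_clm_restrict_sq I L
    · exact hμ.integral_clm_restrict I L
  rw [IsGaussian.charFunDual_eq, IsGaussian.charFunDual_eq, integral_complex_ofReal,
    integral_complex_ofReal, hmean hν, hmean hν', hvar hν, hvar hν']

/-- **A centred Gaussian lattice field is determined in law by its covariance**: two probability
measures on `ℤ^d → ℝ` under which the coordinate process is a discrete free field are equal.
[folklore] -/
theorem eq_of_isDiscreteGFF (hν : IsDiscreteGFF ν (coordProc d)) (hν' : IsDiscreteGFF ν' (coordProc d)) :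
    ν = ν' := by
  have hP := hν.1.isProbabilityMeasure
  set P : ∀ J : Finset (Site d), Measure (∀ _ : J, ℝ) := fun J => ν.map J.restrict with hPdef
  have h1 : IsProjectiveLimit ν P := fun I => rfl
  have h2 : IsProjectiveLimit ν' P := fun I => (hν.map_restrict_eq hν' I).symm
  have : ∀ J, IsFiniteMeasure (P J) := fun J => by rw [hPdef]; infer_instance
  exact h1.unique h2

/-- **Translation invariance of the free-field law**: `ν ∘ (φ ↦ φ(· + v))⁻¹ = ν`.
[cite: Lupu2016, Lemma 5.3 (translation invariance)] -/
theorem map_shift_eq (hν : IsDiscreteGFF ν (coordProc d)) (v : Site d) :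
    ν.map (fun (φ : Site d → ℝ) (x : Site d) => φ (x + v)) = ν := by
  refine eq_of_isDiscreteGFF ?_ hν
  -- the translated coordinate process is a free field under `ν`
  have hg : IsDiscreteGFF ν (fun (x : Site d) (φ : Site d → ℝ) => φ (x + v)) := by
    refine ⟨hν.1.comp_right (· + v), fun x => hν.2.1 (x + v), fun x y => ?_⟩
    rw [hν.2.2 (x + v) (y + v), add_sub_add_right_eq_sub]
  exact hg.map_field

end IsDiscreteGFF

end Literature.Probability.LatticeModels
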